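import Mathlib
import Summits.NavierStokesRegularity.NavierStokesRegularity.Theorems.SubOnsagerCeilingSideBranchOccupationHorizon
import Summits.NavierStokesRegularity.NavierStokesRegularity.Theorems.SubOnsagerCeilingSideBranchCaptureSecondMoment
import HarnessLib

/-!
# Route SubOnsagerCeiling — the TWO-LAW OCCUPATION BOUND ON HORIZONS refutes the aside cruxes
# (operative reduction, def-free; helper file for item stmt-NavierStokesRegularity-25507 `OrthantTailCeiling`; `--supports`)

Sharpening of `…SideBranchOccupationHorizon.lean` (p827133).  There every pocket `z_{j+1}` of `α_SB` is bounded by the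
FOURTH-MOMENT capture law alone, `½z_{j+1}² ≤ ½(4e^{ν_{j+1}t}(Λ_j/5)∫₀ᵗx_j⁴)^{2/3}`; on the true trajectory (memo
OCCUPATION-LEAK-leafhand4-g12.md §4: b = 2, t = 3.75) the sum of these bounds over `j < 8` is already `1.50·E₀ > E₀`, so that
hypothesis cannot be met at pump `1/5`.  With the SECOND-MOMENT capture law (`sideBranch_capture_second_moment`, this lineage:
`z_{j+1}² ≤ ((Λ_j/5)∫₀ᵗx_j²)²`, sharp on the low shells) each pocket is below the MINIMUM of the two laws, and the operative
target becomes the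

**TWO-LAW OCCUPATION BOUND ON HORIZONS** (hypothesis inline in `sideBranchCeilingEscapeAt_of_twoLawOccupationBoundOnHorizons`):
as in p827133, but with `Σ_{j<K} ½·min{ (4e^{ν_{j+1}t}(Λ_j/5)∫₀ᵗx_j⁴)^{2/3}, ((Λ_j/5)∫₀ᵗx_j²)² } ≤ (1 − q)·E₀`
(numerically `0.67·E₀` at pump `1/5`, `0.23·E₀` at pump `1/20` on the true trajectory — a statement about the CHAIN occupations only).

* **`sideBranchCeilingEscapeAt_of_twoLawOccupationBoundOnHorizons`** — TWO-LAW BOUND (`q`) `⇒ SideBranchCeilingEscapeAt ε₀`;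
* `orthantTailCeiling_false_of_twoLawOccupationBoundOnHorizons`, `forwardTailCeiling_false_of_twoLawOccupationBoundOnHorizons`
  — the aside cruxes stmt-25507 / stmt-26608 BY NAME modulo it.

NOT proved here: any bound on the chain occupations `∫x_j²`, `∫x_j⁴` (the open, Kolmogorov-type input «R-A»).
HONEST FRAMING: MODEL lattice ODEs only (Tao 2016 §4 vocabulary; rung TL-M2Break); a reduction between unproved statements;
settles nothing by itself; nothing here is a statement about the Navier–Stokes equations.
[cite: Tao2016AveragedNS, §4 (4.2)–(4.3), (4.5)]; Katz–Pavlović couplings: [cite: BarbatoMorandinRomito2011, §2].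
-/

noncomputable section

-- the sub-problem namespace `NavierStokesRegularity.NavierStokesRegularity` is the tree's layout (D-0017)
set_option linter.dupNamespace false

namespace Summit.NavierStokesRegularity.NavierStokesRegularity.Theorems.SubOnsagerCeiling

open Set Filter MeasureTheory intervalIntegral
open scoped Topology
open Literature.Analysis.FluidPDE.TaoCascade
open Summit.NavierStokesRegularity.NavierStokesRegularity.Theses.SubOnsagerCeiling

/-- **TWO-LAW OCCUPATION BOUND ON HORIZONS `→ SideBranchCeilingEscapeAt ε₀`** (hypothesis inline: `q > 0`; for every
`(θ, C)` a chain datum `X₀` (`X₀ 0 ≥ 0`, `X₀ 1 = X₀ 2 = X₀ 3 = 0`, `E₀ > 0`); for every depth `K` and horizon `T > 0` a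
threshold `ν₀ > 0`; for all `0 < ν ≤ ν₀`, all `0 < s ≤ T` and every regular `ν`-viscous solution of `α_SB` on `[0,s]` from
`X₀`, non-negative on the shells `≥ 1` and obeying the `(θ, C)` tail ceiling:
`Σ_{j<K} ½·min{(4e^{ν_{j+1}t}(Λ_j/5)∫₀ᵗx_j⁴)^{2/3}, ((Λ_j/5)∫₀ᵗx_j²)²} ≤ (1−q)E₀` for all `t ∈ [0,s]`).
Proof: pocket `0` is empty, pocket `j+1` is below both capture laws. MODEL lattice only; a reduction between unproved
statements. [this file] -/
theorem sideBranchCeilingEscapeAt_of_twoLawOccupationBoundOnHorizons {ε₀ q : ℝ} (hε : 0 < ε₀) (hq : 0 < q)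
    (h : ∀ θ : ℝ, 1 / 2 < θ → ∀ C : ℝ, 0 ≤ C →
      ∃ X₀ : Fin 4 → ℝ, 0 ≤ X₀ 0 ∧ X₀ 1 = 0 ∧ X₀ 2 = 0 ∧ X₀ 3 = 0 ∧
      0 < (∑ i : Fin 4, (1 / 2 : ℝ) * X₀ i ^ 2) ∧
      ∀ K : ℕ, ∀ T : ℝ, 0 < T → ∃ ν₀ : ℝ, 0 < ν₀ ∧ ∀ ν : ℝ, 0 < ν → ν ≤ ν₀ →
      ∀ s : ℝ, 0 < s → s ≤ T →
      ∀ X : Fin 4 → ℤ → ℝ → ℝ,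
      (∀ (i : Fin 4) (k : ℤ), X i k 0 = if k = 0 then X₀ i else 0) →
      (∀ (i : Fin 4) (k : ℤ), k < 0 → ∀ t : ℝ, X i k t = 0) →
      (∃ M : ℝ, ∀ (t : ℝ) (i : Fin 4) (k : ℤ), (1 + (1 + ε₀) ^ ((10 : ℝ) * k)) * |X i k t| ≤ M) →
      (∀ (i : Fin 4) (k : ℤ), Continuous (X i k)) →
      (∀ (i : Fin 4) (k : ℤ), ∀ t ∈ Set.Icc (0 : ℝ) s, HasDerivWithinAt (X i k)
      (quadTerm ε₀ sideBranchTable X i k t - ν * (1 + ε₀) ^ ((2 : ℝ) * k) * X i k t)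
      (Set.Icc (0 : ℝ) s) t) →
      (∀ t ∈ Set.Icc (0 : ℝ) s, ∀ (i : Fin 4) (k : ℤ), 1 ≤ k → 0 ≤ X i k t) →
      (∀ n N : ℕ, n ≤ N → ∀ u ∈ Set.Icc (0 : ℝ) s,
      ∑ k ∈ Finset.Icc n N, ∑ i : Fin 4, (1 / 2 : ℝ) * X i (k : ℤ) u ^ 2 ≤
      C * (∑ i : Fin 4, (1 / 2 : ℝ) * X₀ i ^ 2) * (1 + ε₀) ^ (-(2 * θ * (n : ℝ)))) →
      ∀ t ∈ Set.Icc (0 : ℝ) s,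
      (∑ j ∈ Finset.range K, (1 / 2 : ℝ) *
        min ((4 * Real.exp (ν * (1 + ε₀) ^ ((2 : ℝ) * (((j : ℤ) + 1 : ℤ) : ℝ)) * t) *
          ((1 / 5 : ℝ) * (1 + ε₀) ^ ((5 : ℝ) * ((j : ℤ) : ℝ) / 2) *
            ∫ u in (0 : ℝ)..t, X 0 (j : ℤ) u ^ 4)) ^ ((2 : ℝ) / 3))
          (((1 / 5 : ℝ) * (1 + ε₀) ^ ((5 : ℝ) * ((j : ℤ) : ℝ) / 2) *
            ∫ u in (0 : ℝ)..t, X 0 (j : ℤ) u ^ 2) ^ 2)) ≤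
      (1 - q) * (∑ i : Fin 4, (1 / 2 : ℝ) * X₀ i ^ 2)) :
    SideBranchCeilingEscapeAt ε₀ := by
  refine sideBranchCeilingEscapeAt_of_parkingBoundOnHorizons hε hq fun θ hθ C hC => ?_
  obtain ⟨X₀, hX0, hX1, hX2, hX3, hE₀, hK⟩ := h θ hθ C hC
  refine ⟨X₀, hX0, hX1.symm.le, hX2.symm.le, hX3, hE₀, fun K T hT => ?_⟩
  obtain ⟨ν₀, hν₀, hocc⟩ := hK K T hT
  refine ⟨ν₀, hν₀, fun ν hν hνle s hs hsT X hinit hlow hbd hcont hder hpos hceil t ht => ?_⟩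
  have hocc' := hocc ν hν hνle s hs hsT X hinit hlow hbd hcont hder hpos hceil t ht
  -- pocket `0` is empty, pocket `j+1` is below both capture laws
  have hz0 : X 2 0 t = 0 :=
    sideBranch_pocket_zero_eq_zero hlow hder (by rw [hinit 2 0]; simp [hX2]) ht
  have hstep : ∀ j ∈ Finset.range K, (1 / 2 : ℝ) * X 2 (((j + 1 : ℕ) : ℤ)) t ^ 2 ≤
      (1 / 2 : ℝ) *
        min ((4 * Real.exp (ν * (1 + ε₀) ^ ((2 : ℝ) * (((j : ℤ) + 1 : ℤ) : ℝ)) * t) *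
          ((1 / 5 : ℝ) * (1 + ε₀) ^ ((5 : ℝ) * ((j : ℤ) : ℝ) / 2) *
            ∫ u in (0 : ℝ)..t, X 0 (j : ℤ) u ^ 4)) ^ ((2 : ℝ) / 3))
          (((1 / 5 : ℝ) * (1 + ε₀) ^ ((5 : ℝ) * ((j : ℤ) : ℝ) / 2) *
            ∫ u in (0 : ℝ)..t, X 0 (j : ℤ) u ^ 2) ^ 2) := by
    intro j _
    have hs0 : X 1 (j : ℤ) 0 = 0 := by
      rw [hinit 1 (j : ℤ)]; by_cases hj : (j : ℤ) = 0 <;> simp [hj, hX1]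
    have hz00 : X 2 ((j : ℤ) + 1) 0 = 0 := by
      rw [hinit 2 ((j : ℤ) + 1)]
      have : ((j : ℤ) + 1) ≠ 0 := by omega
      simp [this]
    have h1 := sideBranch_pocket_sq_le_occupation hε hν.le hcont hder (j : ℤ) hs0 hz00 ht
    have h2 := sideBranch_capture_second_moment hε hν.le hcont hder (j : ℤ) hs0 hz00 ht
    have h2' : X 2 ((j : ℤ) + 1) t ^ 2 ≤
        ((1 / 5 : ℝ) * (1 + ε₀) ^ ((5 : ℝ) * ((j : ℤ) : ℝ) / 2) * ∫ u in (0 : ℝ)..t, X 0 (j : ℤ) u ^ 2) ^ 2 := by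
      nlinarith [sq_nonneg (X 1 (j : ℤ) t)]
    have hidx : (((j + 1 : ℕ) : ℤ)) = (j : ℤ) + 1 := by push_cast; ring
    rw [hidx]
    have hmin := le_min h1 h2'
    push_cast at hmin ⊢
    linarith
  rw [Finset.sum_range_succ', Nat.cast_zero, hz0]
  simp only [ne_eq, OfNat.ofNat_ne_zero, not_false_eq_true, zero_pow, mul_zero, add_zero]
  exact (Finset.sum_le_sum hstep).trans hocc'

/-- **`OrthantTailCeiling` (stmt-25507) BY NAME modulo the TWO-LAW occupation bound ON HORIZONS at some `ε₀ ∈ (0,1]`**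
(hypothesis inline, shape of `sideBranchCeilingEscapeAt_of_twoLawOccupationBoundOnHorizons`). MODEL lattice only; conditional;
settles nothing by itself. [this file] -/
theorem orthantTailCeiling_false_of_twoLawOccupationBoundOnHorizons
    (h : ∃ ε₀ : ℝ, 0 < ε₀ ∧ ε₀ ≤ 1 ∧ ∃ q : ℝ, 0 < q ∧
      ∀ θ : ℝ, 1 / 2 < θ → ∀ C : ℝ, 0 ≤ C →
      ∃ X₀ : Fin 4 → ℝ, 0 ≤ X₀ 0 ∧ X₀ 1 = 0 ∧ X₀ 2 = 0 ∧ X₀ 3 = 0 ∧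
      0 < (∑ i : Fin 4, (1 / 2 : ℝ) * X₀ i ^ 2) ∧
      ∀ K : ℕ, ∀ T : ℝ, 0 < T → ∃ ν₀ : ℝ, 0 < ν₀ ∧ ∀ ν : ℝ, 0 < ν → ν ≤ ν₀ →
      ∀ s : ℝ, 0 < s → s ≤ T →
      ∀ X : Fin 4 → ℤ → ℝ → ℝ,
      (∀ (i : Fin 4) (k : ℤ), X i k 0 = if k = 0 then X₀ i else 0) →
      (∀ (i : Fin 4) (k : ℤ), k < 0 → ∀ t : ℝ, X i k t = 0) →
      (∃ M : ℝ, ∀ (t : ℝ) (i : Fin 4) (k : ℤ), (1 + (1 + ε₀) ^ ((10 : ℝ) * k)) * |X i k t| ≤ M) →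
      (∀ (i : Fin 4) (k : ℤ), Continuous (X i k)) →
      (∀ (i : Fin 4) (k : ℤ), ∀ t ∈ Set.Icc (0 : ℝ) s, HasDerivWithinAt (X i k)
      (quadTerm ε₀ sideBranchTable X i k t - ν * (1 + ε₀) ^ ((2 : ℝ) * k) * X i k t)
      (Set.Icc (0 : ℝ) s) t) →
      (∀ t ∈ Set.Icc (0 : ℝ) s, ∀ (i : Fin 4) (k : ℤ), 1 ≤ k → 0 ≤ X i k t) →
      (∀ n N : ℕ, n ≤ N → ∀ u ∈ Set.Icc (0 : ℝ) s,
      ∑ k ∈ Finset.Icc n N, ∑ i : Fin 4, (1 / 2 : ℝ) * X i (k : ℤ) u ^ 2 ≤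
      C * (∑ i : Fin 4, (1 / 2 : ℝ) * X₀ i ^ 2) * (1 + ε₀) ^ (-(2 * θ * (n : ℝ)))) →
      ∀ t ∈ Set.Icc (0 : ℝ) s,
      (∑ j ∈ Finset.range K, (1 / 2 : ℝ) *
        min ((4 * Real.exp (ν * (1 + ε₀) ^ ((2 : ℝ) * (((j : ℤ) + 1 : ℤ) : ℝ)) * t) *
          ((1 / 5 : ℝ) * (1 + ε₀) ^ ((5 : ℝ) * ((j : ℤ) : ℝ) / 2) *
            ∫ u in (0 : ℝ)..t, X 0 (j : ℤ) u ^ 4)) ^ ((2 : ℝ) / 3))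
          (((1 / 5 : ℝ) * (1 + ε₀) ^ ((5 : ℝ) * ((j : ℤ) : ℝ) / 2) *
            ∫ u in (0 : ℝ)..t, X 0 (j : ℤ) u ^ 2) ^ 2)) ≤
      (1 - q) * (∑ i : Fin 4, (1 / 2 : ℝ) * X₀ i ^ 2)) :
    ¬ OrthantTailCeiling := by
  obtain ⟨ε₀, hε, hε1, q, hq, hocc⟩ := h
  exact orthantTailCeiling_false_of_sideBranchCeilingEscape
    ⟨ε₀, hε, hε1, sideBranchCeilingEscapeAt_of_twoLawOccupationBoundOnHorizons hε hq hocc⟩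

/-- **`ForwardTailCeiling` (stmt-26608) BY NAME modulo the TWO-LAW occupation bound ON HORIZONS at some `ε₀ ∈ (0,1]`**
(twin reduction of record). MODEL lattice only; conditional; settles nothing by itself. [this file] -/
theorem forwardTailCeiling_false_of_twoLawOccupationBoundOnHorizons
    (h : ∃ ε₀ : ℝ, 0 < ε₀ ∧ ε₀ ≤ 1 ∧ ∃ q : ℝ, 0 < q ∧
      ∀ θ : ℝ, 1 / 2 < θ → ∀ C : ℝ, 0 ≤ C →
      ∃ X₀ : Fin 4 → ℝ, 0 ≤ X₀ 0 ∧ X₀ 1 = 0 ∧ X₀ 2 = 0 ∧ X₀ 3 = 0 ∧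
      0 < (∑ i : Fin 4, (1 / 2 : ℝ) * X₀ i ^ 2) ∧
      ∀ K : ℕ, ∀ T : ℝ, 0 < T → ∃ ν₀ : ℝ, 0 < ν₀ ∧ ∀ ν : ℝ, 0 < ν → ν ≤ ν₀ →
      ∀ s : ℝ, 0 < s → s ≤ T →
      ∀ X : Fin 4 → ℤ → ℝ → ℝ,
      (∀ (i : Fin 4) (k : ℤ), X i k 0 = if k = 0 then X₀ i else 0) →
      (∀ (i : Fin 4) (k : ℤ), k < 0 → ∀ t : ℝ, X i k t = 0) →
      (∃ M : ℝ, ∀ (t : ℝ) (i : Fin 4) (k : ℤ), (1 + (1 + ε₀) ^ ((10 : ℝ) * k)) * |X i k t| ≤ M) →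
      (∀ (i : Fin 4) (k : ℤ), Continuous (X i k)) →
      (∀ (i : Fin 4) (k : ℤ), ∀ t ∈ Set.Icc (0 : ℝ) s, HasDerivWithinAt (X i k)
      (quadTerm ε₀ sideBranchTable X i k t - ν * (1 + ε₀) ^ ((2 : ℝ) * k) * X i k t)
      (Set.Icc (0 : ℝ) s) t) →
      (∀ t ∈ Set.Icc (0 : ℝ) s, ∀ (i : Fin 4) (k : ℤ), 1 ≤ k → 0 ≤ X i k t) →
      (∀ n N : ℕ, n ≤ N → ∀ u ∈ Set.Icc (0 : ℝ) s,
      ∑ k ∈ Finset.Icc n N, ∑ i : Fin 4, (1 / 2 : ℝ) * X i (k : ℤ) u ^ 2 ≤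
      C * (∑ i : Fin 4, (1 / 2 : ℝ) * X₀ i ^ 2) * (1 + ε₀) ^ (-(2 * θ * (n : ℝ)))) →
      ∀ t ∈ Set.Icc (0 : ℝ) s,
      (∑ j ∈ Finset.range K, (1 / 2 : ℝ) *
        min ((4 * Real.exp (ν * (1 + ε₀) ^ ((2 : ℝ) * (((j : ℤ) + 1 : ℤ) : ℝ)) * t) *
          ((1 / 5 : ℝ) * (1 + ε₀) ^ ((5 : ℝ) * ((j : ℤ) : ℝ) / 2) *
            ∫ u in (0 : ℝ)..t, X 0 (j : ℤ) u ^ 4)) ^ ((2 : ℝ) / 3))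
          (((1 / 5 : ℝ) * (1 + ε₀) ^ ((5 : ℝ) * ((j : ℤ) : ℝ) / 2) *
            ∫ u in (0 : ℝ)..t, X 0 (j : ℤ) u ^ 2) ^ 2)) ≤
      (1 - q) * (∑ i : Fin 4, (1 / 2 : ℝ) * X₀ i ^ 2)) :
    ¬ ForwardTailCeiling := by
  obtain ⟨ε₀, hε, hε1, q, hq, hocc⟩ := h
  exact forwardTailCeiling_false_of_sideBranchCeilingEscape
    ⟨ε₀, hε, hε1, sideBranchCeilingEscapeAt_of_twoLawOccupationBoundOnHorizons hε hq hocc⟩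

end Summit.NavierStokesRegularity.NavierStokesRegularity.Theorems.SubOnsagerCeiling

end
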